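import Summits.ResolutionOfSingularities.ResolutionOfSingularities.Theorems.FrobeniusLadderFInjectiveMacaulayficationMonicTowerPrime
import Mathlib.FieldTheory.KummerPolynomial
import Mathlib.FieldTheory.IntermediateField.Adjoin.Basic
import Mathlib.FieldTheory.Minpoly.Field
import HarnessLib

/-!
# GENERIC THREE-STEP MONIC-TOWER PRIMALITY: `(x₀² + ιE₀, x₁³ + ιE₁, x₂⁵ + ιE₂) ⊂ k[x₀, …, x₆]` is prime whenever `−E₂` is not a fifth power, `−E₁` not a cube and `−E₀`
# not a square in `C = k[x₃, …, x₆]` — the degrees `5, 3, 2` being pairwise coprime, each step stays irreducible over the field below it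
# (crux `FInjectiveMacaulayfication` stmt-ResolutionOfSingularities-15315, chain w45a; res-L1-w45a-plan-1 RULING R23.22 (β) «a second equal-support bed of different codimension … via the
# reusable tower lemmas»; seat res-L1-w45a-stub-2 g13)

[OURS · L1 W4.5a] Support file (`--supports stmt-ResolutionOfSingularities-15315 --as helper`); def-free; UNCONDITIONAL; no named fact, no sorry; NOT a statement of any
manuscript; replaces the role of NO printed item. Nothing of the crux is proved. AI-written (AI review weaker than expert review).

* §1 (fields) `irreducible_map_of_not_dvd_finrank` — a monic irreducible `g ∈ K[X]` of degree `2 ≤ d ≤ 3` stays irreducible over every finite extension `L/K` with `d ∤ [L:K]` (a root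
  `β` would have `[K(β):K] = d ∣ [L:K]`, `minpoly.degree_dvd`); `irreducible_quintic` — `X⁵ + E` is irreducible over `Frac D` when `−E` is not a fifth power in the integrally closed
  domain `D` (Kummer ✓ `X_pow_sub_C_irreducible_of_prime` + integrality).
* §2 (the tower over an integrally closed domain `D`) `isDomain_T₁/T₂/T₃` for `T₁ = D[X]/(X⁵ + E₂)`, `T₂ = T₁[X]/(X³ + E₁)`, `T₃ = T₂[X]/(X² + E₀)`: `T₁ ↪ L₁ = K₀[X]/(X⁵+E₂)`
  (`[L₁:K₀] = 5`), `X³ + E₁` irreducible over `L₁` (`3 ∤ 5`), `T₂ ↪ L₂` (`[L₂:K₀] = 15`), `X² + E₀` irreducible over `L₂` (`2 ∤ 15`) — ✓ `DiagonalBPCIPrime.injective_of_monic`,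
  ✓ `isDomain_adjoinRoot_of_irreducible_map`.
* §3 ★★ `isPrime_span_tower3` — for `E₀, E₁, E₂ ∈ C = k[X 0..X 3]` (embedded by `ι : X m ↦ X (m+3)` into `k[x₀..x₆]`): the ideal `(x₀² + ιE₀, x₁³ + ιE₁, x₂⁵ + ιE₂)` is PRIME and
  `x₃, …, x₆ ∉` it (`Φ : k[x] → T₃`, left inverse by three universal properties).
[cite: Matsumura1987, Thm. 9.1] [folklore: Kummer, tower law]
-/

-- single-problem summit: the doubled namespace component is forced
set_option linter.dupNamespace false

noncomputable section

open Polynomial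

namespace Summit.ResolutionOfSingularities.ResolutionOfSingularities.Theorems.FInjectiveMacaulayfication.MonicTowerThreePrime

open Summit.ResolutionOfSingularities.ResolutionOfSingularities.Theorems.FInjectiveMacaulayfication DiagonalBPCIPrime

/-! ## §1 Irreducibility over finite extensions of coprime degree; the quintic -/

/-- **A monic irreducible polynomial of degree `2` or `3` stays irreducible over a finite extension of degree not divisible by its degree**: a root `β ∈ L` would give
`[K(β) : K] = deg g ∣ [L : K]`. [folklore: tower law] -/
theorem irreducible_map_of_not_dvd_finrank {K L : Type} [Field K] [Field L] [Algebra K L] [FiniteDimensional K L] (g : K[X]) (hg : Irreducible g)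
    (hmonic : g.Monic) (h2 : 2 ≤ g.natDegree) (h3 : g.natDegree ≤ 3) (hdvd : ¬ g.natDegree ∣ Module.finrank K L) :
    Irreducible (g.map (algebraMap K L)) := by
  have hmonic' : (g.map (algebraMap K L)).Monic := hmonic.map _
  refine (hmonic'.irreducible_iff_roots_eq_zero_of_degree_le_three (by rwa [Polynomial.natDegree_map]) (by rwa [Polynomial.natDegree_map])).mpr
    (Multiset.eq_zero_iff_forall_notMem.mpr fun β hβ => ?_)
  rw [Polynomial.mem_roots hmonic'.ne_zero, Polynomial.IsRoot.def, Polynomial.eval_map_algebraMap] at hβ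
  have hint : IsIntegral K β := Algebra.IsIntegral.isIntegral β
  have hmin : g = minpoly K β := minpoly.eq_of_irreducible_of_monic hg hβ hmonic
  have h := minpoly.degree_dvd hint
  rw [← hmin] at h
  exact hdvd h

section Domain

variable (D : Type) [CommRing D] [IsDomain D] [IsIntegrallyClosed D]

omit [IsDomain D] in
/-- `X⁵ + E` has NO ROOT in `K₀ = Frac D` if it has none in `D` (integrality). [folklore] -/
theorem no_root_quintic (E : D) (hE : ∀ y : D, y ^ 5 + E ≠ 0) (ρ : FractionRing D) : ρ ^ 5 + algebraMap D (FractionRing D) E ≠ 0 := by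
  intro h0
  have hint : IsIntegral D ρ := by
    refine ⟨X ^ 5 + Polynomial.C E, Polynomial.monic_X_pow_add_C _ (by norm_num), ?_⟩
    simp only [Polynomial.eval₂_add, Polynomial.eval₂_X_pow, Polynomial.eval₂_C]
    exact h0
  obtain ⟨y, hy⟩ := IsIntegrallyClosed.algebraMap_eq_of_integral hint
  apply hE y
  apply IsFractionRing.injective D (FractionRing D)
  rw [map_add, map_pow, hy, h0, map_zero]

/-- ★ **`X⁵ + E` IS IRREDUCIBLE OVER `K₀ = Frac D`** when `−E` is not a fifth power in `D` (Kummer's criterion for the prime exponent `5`). [folklore: Kummer] -/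
theorem irreducible_quintic (E : D) (hE : ∀ y : D, y ^ 5 + E ≠ 0) (f₁ : D[X]) (hf₁ : f₁ = X ^ 5 + Polynomial.C E) :
    Irreducible (f₁.map (algebraMap D (FractionRing D))) := by
  have hmap : f₁.map (algebraMap D (FractionRing D)) = X ^ 5 - Polynomial.C (-(algebraMap D (FractionRing D) E)) := by
    rw [hf₁, Polynomial.map_add, Polynomial.map_pow, Polynomial.map_X, Polynomial.map_C, map_neg, sub_neg_eq_add]
  rw [hmap]
  refine X_pow_sub_C_irreducible_of_prime Nat.prime_five fun b hb => no_root_quintic D E hE b ?_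
  rw [hb, neg_add_cancel]

omit [IsIntegrallyClosed D] in
/-- `f₁ = X⁵ + E` is monic of degree `5`. [plumbing] -/
theorem monic_quintic (E : D) (f₁ : D[X]) (hf₁ : f₁ = X ^ 5 + Polynomial.C E) : f₁.Monic ∧ f₁.natDegree = 5 := by
  rw [hf₁]; exact ⟨Polynomial.monic_X_pow_add_C _ (by norm_num), Polynomial.natDegree_X_pow_add_C⟩

/-- `X³ + E` is monic of degree `3`; `X² + E` is monic of degree `2` (over any ring). [plumbing] -/
theorem monic_cubic_quadratic {R : Type} [CommRing R] [Nontrivial R] (E : R) :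
    ((X ^ 3 + Polynomial.C E : R[X]).Monic ∧ (X ^ 3 + Polynomial.C E : R[X]).natDegree = 3) ∧
      ((X ^ 2 + Polynomial.C E : R[X]).Monic ∧ (X ^ 2 + Polynomial.C E : R[X]).natDegree = 2) :=
  ⟨⟨Polynomial.monic_X_pow_add_C _ (by norm_num), Polynomial.natDegree_X_pow_add_C⟩, ⟨Polynomial.monic_X_pow_add_C _ (by norm_num), Polynomial.natDegree_X_pow_add_C⟩⟩

/-- `X² + E` is irreducible over `K₀` when `−E` is not a square in `D` (quadratic without a root; ✓ `MonicTowerPrime.no_root_quadratic` with `G = −E`). [folklore] -/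
theorem irreducible_quadratic_K₀ (E : D) (hE : ∀ y : D, y ^ 2 + E ≠ 0) :
    Irreducible ((X ^ 2 + Polynomial.C E : D[X]).map (algebraMap D (FractionRing D))) := by
  have hmap : (X ^ 2 + Polynomial.C E : D[X]).map (algebraMap D (FractionRing D)) = X ^ 2 - Polynomial.C (algebraMap D (FractionRing D) (-E)) := by
    rw [Polynomial.map_add, Polynomial.map_pow, Polynomial.map_X, Polynomial.map_C, map_neg, map_neg, sub_neg_eq_add]
  rw [hmap]
  have hmonic := Polynomial.monic_X_pow_sub_C (algebraMap D (FractionRing D) (-E)) two_ne_zero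
  refine (hmonic.irreducible_iff_roots_eq_zero_of_degree_le_three Polynomial.natDegree_X_pow_sub_C.ge
    (by rw [Polynomial.natDegree_X_pow_sub_C]; norm_num)).mpr (Multiset.eq_zero_iff_forall_notMem.mpr fun σ hσ => ?_)
  rw [Polynomial.mem_roots hmonic.ne_zero, Polynomial.IsRoot.def, Polynomial.eval_sub, Polynomial.eval_pow, Polynomial.eval_X, Polynomial.eval_C, sub_eq_zero] at hσ
  exact MonicTowerPrime.no_root_quadratic D (-E) (fun y hy => hE y (by rw [hy, neg_add_cancel])) σ hσ

/-! ## §2 The three-step tower `D[X]/(X⁵+E₂)[X]/(X³+E₁)[X]/(X²+E₀)` is a domain -/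

set_option synthInstance.maxHeartbeats 400000 in
set_option maxHeartbeats 2000000 in
-- three stacked `AdjoinRoot` field structures: instance unification on the third floor is slow
/-- ★★ **THE THREE-STEP TOWER IS A DOMAIN**: `T₁ = D[X]/(X⁵ + E₂)`, `T₂ = T₁[X]/(X³ + E₁)`, `T₃ = T₂[X]/(X² + E₀)` with `−E₂` no fifth power, `−E₁` no cube, `−E₀` no square in `D`.
The field tower `K₀ ⊂ L₁ ⊂ L₂` has degrees `5` and `3`, so the cubic and the quadratic stay irreducible (`3 ∤ 5`; `2 ∤ 5`, `2 ∤ 3`), and each `Tᵢ` embeds in `Lᵢ`. [folklore] -/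
theorem isDomain_T₃ (E₀ E₁ E₂ : D) (hE₀ : ∀ y : D, y ^ 2 + E₀ ≠ 0) (hE₁ : ∀ y : D, y ^ 3 + E₁ ≠ 0) (hE₂ : ∀ y : D, y ^ 5 + E₂ ≠ 0)
    (f₁ : D[X]) (hf₁ : f₁ = X ^ 5 + Polynomial.C E₂)
    (f₂ : Polynomial (AdjoinRoot f₁)) (hf₂ : f₂ = X ^ 3 + Polynomial.C (AdjoinRoot.of f₁ E₁))
    (f₃ : Polynomial (AdjoinRoot f₂)) (hf₃ : f₃ = X ^ 2 + Polynomial.C (AdjoinRoot.of f₂ (AdjoinRoot.of f₁ E₀))) :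
    IsDomain (AdjoinRoot f₁) ∧ IsDomain (AdjoinRoot f₂) ∧ IsDomain (AdjoinRoot f₃) := by
  -- step 1: `T₁ ↪ L₁ = K₀[X]/(X⁵ + E₂)`, a field of degree 5
  haveI hirr₁ : Fact (Irreducible (f₁.map (algebraMap D (FractionRing D)))) := ⟨irreducible_quintic D E₂ hE₂ f₁ hf₁⟩
  have hm₁ := monic_quintic D E₂ f₁ hf₁
  have hT₁ : IsDomain (AdjoinRoot f₁) :=
    isDomain_adjoinRoot_of_irreducible_map _ (IsFractionRing.injective D (FractionRing D)) f₁ hm₁.1 hirr₁.out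
  obtain ⟨ρ₁, hρ₁C, hρ₁X⟩ := exists_hom_of_monic (algebraMap D (FractionRing D)) f₁
  have hinj₁ := injective_of_monic _ (IsFractionRing.injective D (FractionRing D)) f₁ hm₁.1 ρ₁ hρ₁C hρ₁X
  have hfin₁ : Module.finrank (FractionRing D) (AdjoinRoot (f₁.map (algebraMap D (FractionRing D)))) = 5 := by
    rw [(AdjoinRoot.powerBasis hirr₁.out.ne_zero).finrank, AdjoinRoot.powerBasis_dim, hm₁.1.natDegree_map, hm₁.2]
  haveI : FiniteDimensional (FractionRing D) (AdjoinRoot (f₁.map (algebraMap D (FractionRing D)))) := (AdjoinRoot.powerBasis hirr₁.out.ne_zero).finite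
  -- step 2: `X³ + E₁` irreducible over `L₁` (3 ∤ 5); `T₂ ↪ L₂`
  have hg₂ : f₂.map ρ₁ = ((X ^ 3 + Polynomial.C E₁ : D[X]).map (algebraMap D (FractionRing D))).map (algebraMap (FractionRing D) _) := by
    rw [hf₂, Polynomial.map_add, Polynomial.map_pow, Polynomial.map_X, Polynomial.map_C, hρ₁C, Polynomial.map_add, Polynomial.map_pow, Polynomial.map_X,
      Polynomial.map_C, Polynomial.map_add, Polynomial.map_pow, Polynomial.map_X, Polynomial.map_C, AdjoinRoot.algebraMap_eq]
  have hirr₂K := MonicTowerPrime.irreducible_cubic D E₁ hE₁ _ rfl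
  have hm₂K := (monic_cubic_quadratic (algebraMap D (FractionRing D) E₁)).1
  have hmapK₂ : (X ^ 3 + Polynomial.C E₁ : D[X]).map (algebraMap D (FractionRing D)) = X ^ 3 + Polynomial.C (algebraMap D (FractionRing D) E₁) := by
    rw [Polynomial.map_add, Polynomial.map_pow, Polynomial.map_X, Polynomial.map_C]
  haveI hirr₂ : Fact (Irreducible (f₂.map ρ₁)) := ⟨by
    rw [hg₂, hmapK₂]
    rw [hmapK₂] at hirr₂K
    exact irreducible_map_of_not_dvd_finrank _ hirr₂K hm₂K.1 (by norm_num [hm₂K.2]) (by norm_num [hm₂K.2]) (by rw [hm₂K.2, hfin₁]; norm_num)⟩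
  have hm₂ : f₂.Monic ∧ f₂.natDegree = 3 := by
    haveI : Nontrivial (AdjoinRoot f₁) := hT₁.toNontrivial
    rw [hf₂]; exact (monic_cubic_quadratic _).1
  have hT₂ : IsDomain (AdjoinRoot f₂) := isDomain_adjoinRoot_of_irreducible_map ρ₁ hinj₁ f₂ hm₂.1 hirr₂.out
  obtain ⟨ρ₂, hρ₂C, hρ₂X⟩ := exists_hom_of_monic ρ₁ f₂
  have hinj₂ := injective_of_monic ρ₁ hinj₁ f₂ hm₂.1 ρ₂ hρ₂C hρ₂X
  have hfin₂ : Module.finrank (AdjoinRoot (f₁.map (algebraMap D (FractionRing D)))) (AdjoinRoot (f₂.map ρ₁)) = 3 := by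
    rw [(AdjoinRoot.powerBasis hirr₂.out.ne_zero).finrank, AdjoinRoot.powerBasis_dim, hm₂.1.natDegree_map, hm₂.2]
  haveI : FiniteDimensional (AdjoinRoot (f₁.map (algebraMap D (FractionRing D)))) (AdjoinRoot (f₂.map ρ₁)) :=
    (AdjoinRoot.powerBasis hirr₂.out.ne_zero).finite
  -- step 3: `X² + E₀` irreducible over `L₁` (2 ∤ 5), then over `L₂` (2 ∤ 3)
  set e₀ : AdjoinRoot (f₁.map (algebraMap D (FractionRing D))) :=
    algebraMap (FractionRing D) (AdjoinRoot (f₁.map (algebraMap D (FractionRing D)))) (algebraMap D (FractionRing D) E₀) with he₀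
  have hirr₃K := irreducible_quadratic_K₀ D E₀ hE₀
  have hm₃K := (monic_cubic_quadratic (algebraMap D (FractionRing D) E₀)).2
  have hmapK₃ : (X ^ 2 + Polynomial.C E₀ : D[X]).map (algebraMap D (FractionRing D)) = X ^ 2 + Polynomial.C (algebraMap D (FractionRing D) E₀) := by
    rw [Polynomial.map_add, Polynomial.map_pow, Polynomial.map_X, Polynomial.map_C]
  rw [hmapK₃] at hirr₃K
  have hirr₃L₁ : Irreducible (X ^ 2 + Polynomial.C e₀ : (AdjoinRoot (f₁.map (algebraMap D (FractionRing D))))[X]) := by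
    have h := irreducible_map_of_not_dvd_finrank (L := AdjoinRoot (f₁.map (algebraMap D (FractionRing D)))) _ hirr₃K hm₃K.1 (by norm_num [hm₃K.2])
      (by norm_num [hm₃K.2]) (by rw [hm₃K.2, hfin₁]; norm_num)
    rwa [Polynomial.map_add, Polynomial.map_pow, Polynomial.map_X, Polynomial.map_C] at h
  have hm₃L₁ := (monic_cubic_quadratic e₀).2
  have hg₃ : f₃.map ρ₂ = (X ^ 2 + Polynomial.C e₀ : (AdjoinRoot (f₁.map (algebraMap D (FractionRing D))))[X]).map
      (algebraMap (AdjoinRoot (f₁.map (algebraMap D (FractionRing D)))) (AdjoinRoot (f₂.map ρ₁))) := by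
    rw [hf₃, Polynomial.map_add, Polynomial.map_pow, Polynomial.map_X, Polynomial.map_C, hρ₂C, hρ₁C, Polynomial.map_add, Polynomial.map_pow, Polynomial.map_X,
      Polynomial.map_C, he₀, AdjoinRoot.algebraMap_eq, AdjoinRoot.algebraMap_eq]
  have hirr₃ : Irreducible (f₃.map ρ₂) := by
    rw [hg₃]
    exact irreducible_map_of_not_dvd_finrank _ hirr₃L₁ hm₃L₁.1 (by norm_num [hm₃L₁.2]) (by norm_num [hm₃L₁.2]) (by rw [hm₃L₁.2, hfin₂]; norm_num)
  have hm₃ : f₃.Monic := by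
    haveI : Nontrivial (AdjoinRoot f₂) := hT₂.toNontrivial
    rw [hf₃]; exact (monic_cubic_quadratic _).2.1
  exact ⟨hT₁, hT₂, isDomain_adjoinRoot_of_irreducible_map (L := AdjoinRoot (f₂.map ρ₁)) ρ₂ hinj₂ f₃ hm₃ hirr₃⟩

end Domain

/-! ## §3 ★★ Seven variables: the tower ideal `(x₀² + ιE₀, x₁³ + ιE₁, x₂⁵ + ιE₂)` is prime -/

variable (k : Type) [Field k]

/-- ★★ **GENERIC THREE-STEP TOWER PRIMALITY.** For `E₀, E₁, E₂ ∈ C = k[X 0, …, X 3]` (embedded into `k[x₀, …, x₆]` by `ι : X m ↦ X (m+3)`) with `−E₀` not a square, `−E₁` not a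
cube and `−E₂` not a fifth power in `C`: the ideal `I = (x₀² + ιE₀, x₁³ + ιE₁, x₂⁵ + ιE₂)` is PRIME, and `x₃, …, x₆ ∉ I`. (`Φ : k[x] → T₃`, `x₀ ↦ X̄₃`, `x₁ ↦ X̄₂`, `x₂ ↦ X̄₁`,
`x_{m+3} ↦ X m`, kills `I`; three universal properties give a left inverse `T₃ → k[x]/I`; `T₃` is a domain by `isDomain_T₃`.) [folklore] -/
theorem isPrime_span_tower3 (E₀ E₁ E₂ : MvPolynomial (Fin 4) k) (hE₀ : ∀ y : MvPolynomial (Fin 4) k, y ^ 2 + E₀ ≠ 0)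
    (hE₁ : ∀ y : MvPolynomial (Fin 4) k, y ^ 3 + E₁ ≠ 0) (hE₂ : ∀ y : MvPolynomial (Fin 4) k, y ^ 5 + E₂ ≠ 0)
    (I : Ideal (MvPolynomial (Fin 7) k))
    (hI : I = Ideal.span {(MvPolynomial.X 0 : MvPolynomial (Fin 7) k) ^ 2 +
        MvPolynomial.eval₂Hom MvPolynomial.C ![MvPolynomial.X 3, MvPolynomial.X 4, MvPolynomial.X 5, MvPolynomial.X 6] E₀,
      (MvPolynomial.X 1 : MvPolynomial (Fin 7) k) ^ 3 +
        MvPolynomial.eval₂Hom MvPolynomial.C ![MvPolynomial.X 3, MvPolynomial.X 4, MvPolynomial.X 5, MvPolynomial.X 6] E₁,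
      (MvPolynomial.X 2 : MvPolynomial (Fin 7) k) ^ 5 +
        MvPolynomial.eval₂Hom MvPolynomial.C ![MvPolynomial.X 3, MvPolynomial.X 4, MvPolynomial.X 5, MvPolynomial.X 6] E₂}) :
    I.IsPrime ∧ ∀ m : Fin 4, (![MvPolynomial.X 3, MvPolynomial.X 4, MvPolynomial.X 5, MvPolynomial.X 6] m : MvPolynomial (Fin 7) k) ∉ I := by
  set ι : MvPolynomial (Fin 4) k →+* MvPolynomial (Fin 7) k :=
    MvPolynomial.eval₂Hom MvPolynomial.C ![MvPolynomial.X 3, MvPolynomial.X 4, MvPolynomial.X 5, MvPolynomial.X 6] with hι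
  obtain ⟨f₁, hf₁⟩ : ∃ f₁ : Polynomial (MvPolynomial (Fin 4) k), f₁ = X ^ 5 + Polynomial.C E₂ := ⟨_, rfl⟩
  obtain ⟨f₂, hf₂⟩ : ∃ f₂ : Polynomial (AdjoinRoot f₁), f₂ = X ^ 3 + Polynomial.C (AdjoinRoot.of f₁ E₁) := ⟨_, rfl⟩
  obtain ⟨f₃, hf₃⟩ : ∃ f₃ : Polynomial (AdjoinRoot f₂), f₃ = X ^ 2 + Polynomial.C (AdjoinRoot.of f₂ (AdjoinRoot.of f₁ E₀)) := ⟨_, rfl⟩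
  obtain ⟨hT₁, hT₂, hT₃⟩ := isDomain_T₃ (MvPolynomial (Fin 4) k) E₀ E₁ E₂ hE₀ hE₁ hE₂ f₁ hf₁ f₂ hf₂ f₃ hf₃
  haveI := hT₁
  haveI := hT₂
  haveI := hT₃
  -- `Φ : k[x] → T₃`
  set j₃ : MvPolynomial (Fin 4) k →+* AdjoinRoot f₃ := (AdjoinRoot.of f₃).comp ((AdjoinRoot.of f₂).comp (AdjoinRoot.of f₁)) with hj₃
  set Φ : MvPolynomial (Fin 7) k →+* AdjoinRoot f₃ := MvPolynomial.eval₂Hom (j₃.comp MvPolynomial.C)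
    ![AdjoinRoot.root f₃, AdjoinRoot.of f₃ (AdjoinRoot.root f₂), AdjoinRoot.of f₃ (AdjoinRoot.of f₂ (AdjoinRoot.root f₁)),
      j₃ (MvPolynomial.X 0), j₃ (MvPolynomial.X 1), j₃ (MvPolynomial.X 2), j₃ (MvPolynomial.X 3)] with hΦ
  have hΦC : ∀ a : k, Φ (MvPolynomial.C a) = j₃ (MvPolynomial.C a) := fun a => by
    rw [hΦ, MvPolynomial.eval₂Hom_C, RingHom.comp_apply]
  have hΦX : ∀ i : Fin 7, Φ (MvPolynomial.X i) = ![AdjoinRoot.root f₃, AdjoinRoot.of f₃ (AdjoinRoot.root f₂), AdjoinRoot.of f₃ (AdjoinRoot.of f₂ (AdjoinRoot.root f₁)),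
      j₃ (MvPolynomial.X 0), j₃ (MvPolynomial.X 1), j₃ (MvPolynomial.X 2), j₃ (MvPolynomial.X 3)] i := fun i => by
    rw [hΦ, MvPolynomial.eval₂Hom_X']
  -- `Φ ∘ ι = j₃`
  have hΦι : Φ.comp ι = j₃ := by
    refine MvPolynomial.ringHom_ext (fun a => ?_) (fun m => ?_)
    · rw [RingHom.comp_apply, hι, MvPolynomial.eval₂Hom_C, hΦC]
    · rw [RingHom.comp_apply, hι, MvPolynomial.eval₂Hom_X']
      fin_cases m <;> simp [hΦX]
  -- `Φ` kills the three generators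
  have hR₁ : AdjoinRoot.root f₁ ^ 5 + AdjoinRoot.of f₁ E₂ = 0 := by
    have h : (X ^ 5 + Polynomial.C E₂).eval₂ (AdjoinRoot.of f₁) (AdjoinRoot.root f₁) = 0 := by rw [← hf₁]; exact AdjoinRoot.eval₂_root f₁
    rwa [Polynomial.eval₂_add, Polynomial.eval₂_X_pow, Polynomial.eval₂_C] at h
  have hR₂ : AdjoinRoot.root f₂ ^ 3 + AdjoinRoot.of f₂ (AdjoinRoot.of f₁ E₁) = 0 := by
    have h : (X ^ 3 + Polynomial.C (AdjoinRoot.of f₁ E₁)).eval₂ (AdjoinRoot.of f₂) (AdjoinRoot.root f₂) = 0 := by rw [← hf₂]; exact AdjoinRoot.eval₂_root f₂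
    rwa [Polynomial.eval₂_add, Polynomial.eval₂_X_pow, Polynomial.eval₂_C] at h
  have hR₃ : AdjoinRoot.root f₃ ^ 2 + AdjoinRoot.of f₃ (AdjoinRoot.of f₂ (AdjoinRoot.of f₁ E₀)) = 0 := by
    have h : (X ^ 2 + Polynomial.C (AdjoinRoot.of f₂ (AdjoinRoot.of f₁ E₀))).eval₂ (AdjoinRoot.of f₃) (AdjoinRoot.root f₃) = 0 := by
      rw [← hf₃]; exact AdjoinRoot.eval₂_root f₃
    rwa [Polynomial.eval₂_add, Polynomial.eval₂_X_pow, Polynomial.eval₂_C] at h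
  have hΦP₀ : Φ ((MvPolynomial.X 0 : MvPolynomial (Fin 7) k) ^ 2 + ι E₀) = 0 := by
    rw [map_add, map_pow, hΦX, show Φ (ι E₀) = (Φ.comp ι) E₀ from rfl, hΦι]
    simpa only [Matrix.cons_val_zero, hj₃, RingHom.comp_apply] using hR₃
  have hΦP₁ : Φ ((MvPolynomial.X 1 : MvPolynomial (Fin 7) k) ^ 3 + ι E₁) = 0 := by
    rw [map_add, map_pow, hΦX, show Φ (ι E₁) = (Φ.comp ι) E₁ from rfl, hΦι]
    simp only [Matrix.cons_val_one, Matrix.cons_val_zero, hj₃, RingHom.comp_apply]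
    rw [← map_pow, ← map_add, hR₂, map_zero]
  have hΦP₂ : Φ ((MvPolynomial.X 2 : MvPolynomial (Fin 7) k) ^ 5 + ι E₂) = 0 := by
    rw [map_add, map_pow, hΦX, show Φ (ι E₂) = (Φ.comp ι) E₂ from rfl, hΦι]
    simp only [Matrix.cons_val, hj₃, RingHom.comp_apply]
    rw [← map_pow, ← map_pow, ← map_add, ← map_add, hR₁, map_zero, map_zero]
  -- `ker Φ = I` via the left inverse `Ψ : T₃ → k[x]/I`
  have hker : RingHom.ker Φ = I := by
    set ψ₀ : MvPolynomial (Fin 4) k →+* MvPolynomial (Fin 7) k ⧸ I := (Ideal.Quotient.mk I).comp ι with hψ₀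
    have h₁ : f₁.eval₂ ψ₀ (Ideal.Quotient.mk I (MvPolynomial.X 2)) = 0 := by
      rw [hf₁, Polynomial.eval₂_add, Polynomial.eval₂_X_pow, Polynomial.eval₂_C, hψ₀, RingHom.comp_apply, ← map_pow, ← map_add,
        Ideal.Quotient.eq_zero_iff_mem, hI]
      exact Ideal.subset_span (Or.inr (Or.inr rfl))
    set ψ₁ : AdjoinRoot f₁ →+* MvPolynomial (Fin 7) k ⧸ I := AdjoinRoot.lift ψ₀ (Ideal.Quotient.mk I (MvPolynomial.X 2)) h₁ with hψ₁
    have h₂ : f₂.eval₂ ψ₁ (Ideal.Quotient.mk I (MvPolynomial.X 1)) = 0 := by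
      rw [hf₂, Polynomial.eval₂_add, Polynomial.eval₂_X_pow, Polynomial.eval₂_C, hψ₁, AdjoinRoot.lift_of, hψ₀, RingHom.comp_apply, ← map_pow,
        ← map_add, Ideal.Quotient.eq_zero_iff_mem, hI]
      exact Ideal.subset_span (Or.inr (Or.inl rfl))
    set ψ₂ : AdjoinRoot f₂ →+* MvPolynomial (Fin 7) k ⧸ I := AdjoinRoot.lift ψ₁ (Ideal.Quotient.mk I (MvPolynomial.X 1)) h₂ with hψ₂
    have h₃ : f₃.eval₂ ψ₂ (Ideal.Quotient.mk I (MvPolynomial.X 0)) = 0 := by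
      rw [hf₃, Polynomial.eval₂_add, Polynomial.eval₂_X_pow, Polynomial.eval₂_C, hψ₂, AdjoinRoot.lift_of, hψ₁, AdjoinRoot.lift_of, hψ₀,
        RingHom.comp_apply, ← map_pow, ← map_add, Ideal.Quotient.eq_zero_iff_mem, hI]
      exact Ideal.subset_span (Or.inl rfl)
    set Ψ : AdjoinRoot f₃ →+* MvPolynomial (Fin 7) k ⧸ I := AdjoinRoot.lift ψ₂ (Ideal.Quotient.mk I (MvPolynomial.X 0)) h₃ with hΨ
    have hΨj : ∀ c : MvPolynomial (Fin 4) k, Ψ (j₃ c) = Ideal.Quotient.mk I (ι c) := fun c => by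
      rw [hj₃, RingHom.comp_apply, RingHom.comp_apply, hΨ, AdjoinRoot.lift_of, hψ₂, AdjoinRoot.lift_of, hψ₁, AdjoinRoot.lift_of, hψ₀, RingHom.comp_apply]
    have hcomp : Ψ.comp Φ = Ideal.Quotient.mk I := by
      refine MvPolynomial.ringHom_ext (fun a => ?_) (fun i => ?_)
      · rw [RingHom.comp_apply, hΦC, hΨj, hι, MvPolynomial.eval₂Hom_C]
      · rw [RingHom.comp_apply, hΦX]
        fin_cases i
        · simp only [Fin.zero_eta, Matrix.cons_val_zero]
          rw [hΨ, AdjoinRoot.lift_root]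
        · simp only [Fin.mk_one, Matrix.cons_val_one, Matrix.cons_val_zero]
          rw [hΨ, AdjoinRoot.lift_of, hψ₂, AdjoinRoot.lift_root]
        · simp only [Fin.reduceFinMk, Matrix.cons_val]
          rw [hΨ, AdjoinRoot.lift_of, hψ₂, AdjoinRoot.lift_of, hψ₁, AdjoinRoot.lift_root]
        all_goals
          simp only [Fin.reduceFinMk, Matrix.cons_val]
          rw [hΨj, hι, MvPolynomial.eval₂Hom_X']
          simp
    refine le_antisymm (fun g hg => ?_) ?_
    · rw [RingHom.mem_ker] at hg
      rw [← Ideal.Quotient.eq_zero_iff_mem, ← hcomp, RingHom.comp_apply, hg, map_zero]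
    · rw [hI, Ideal.span_le]
      rintro _ (rfl | rfl | rfl)
      · exact hΦP₀
      · exact hΦP₁
      · exact hΦP₂
  refine ⟨by rw [← hker]; exact RingHom.ker_isPrime Φ, fun m hm => ?_⟩
  -- `x_{m+3} ∉ I`: its image `X m ∈ C ↪ T₁ ↪ T₂ ↪ T₃` is non-zero
  rw [← hker, RingHom.mem_ker, show (![MvPolynomial.X 3, MvPolynomial.X 4, MvPolynomial.X 5, MvPolynomial.X 6] m : MvPolynomial (Fin 7) k) =
    ι (MvPolynomial.X m) by rw [hι, MvPolynomial.eval₂Hom_X'], show Φ (ι (MvPolynomial.X m)) = (Φ.comp ι) (MvPolynomial.X m) from rfl, hΦι,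
    hj₃, RingHom.comp_apply, RingHom.comp_apply] at hm
  have hm₁ := monic_quintic (MvPolynomial (Fin 4) k) E₂ f₁ hf₁
  have hm₂ : f₂.Monic ∧ f₂.natDegree = 3 := by rw [hf₂]; exact (monic_cubic_quadratic _).1
  have hm₃ : f₃.Monic ∧ f₃.natDegree = 2 := by rw [hf₃]; exact (monic_cubic_quadratic _).2
  have hinj₁ : Function.Injective (AdjoinRoot.of f₁) :=
    AdjoinRoot.of.injective_of_degree_ne_zero (by rw [Polynomial.degree_eq_natDegree hm₁.1.ne_zero, hm₁.2]; norm_num)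
  have hinj₂ : Function.Injective (AdjoinRoot.of f₂) :=
    AdjoinRoot.of.injective_of_degree_ne_zero (by rw [Polynomial.degree_eq_natDegree hm₂.1.ne_zero, hm₂.2]; norm_num)
  have hinj₃ : Function.Injective (AdjoinRoot.of f₃) :=
    AdjoinRoot.of.injective_of_degree_ne_zero (by rw [Polynomial.degree_eq_natDegree hm₃.1.ne_zero, hm₃.2]; norm_num)
  have h2 : AdjoinRoot.of f₂ (AdjoinRoot.of f₁ (MvPolynomial.X m)) = 0 := hinj₃ (by rw [hm, map_zero])
  have h1 : AdjoinRoot.of f₁ (MvPolynomial.X m) = 0 := hinj₂ (by rw [h2, map_zero])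
  exact MvPolynomial.X_ne_zero m (hinj₁ (by rw [h1, map_zero]))

end Summit.ResolutionOfSingularities.ResolutionOfSingularities.Theorems.FInjectiveMacaulayfication.MonicTowerThreePrime

end
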